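import Mathlib
import Literature.MathematicalPhysics.QuantumFieldTheory.Balaban1983to89.B6Expansion282

/-!
# `Balaban1983to89.B6Prop23Chain` — p. 238: (2.85) «and by Lemma 2.1 we get Proposition 2.3»: the Neumann series
(2.86) converges and the inverse (Q′G′²Q′*)⁻¹ obeys (2.87) — kernel-checked on the multiscale carrier with the
pairing (2.69), together with the EXISTENCE of the inverse, the finite-overlap assembly of (2.85) from the per-term
bounds of (2.82), and the majorant of the glued approximate inverse C of (2.70) from (2.81)
(B6 = T. Bałaban, *Propagators and renormalization transformations for lattice gauge theories. II*, Commun. Math. Phys.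
**96**, 223–250 (1984) [Balaban1984PropagatorsII]).

CITATION HEADER (lean-in-tree rule 2026-08-18).  Cell `pub-balaban`, unit `b2b-balaban-b06-g11` (paper sub-cell B06,
gen 11 — the owner lineage of `…B6`, `…B6RandomWalk`, `…B6Ineq268`, `…B6Ineq283`, `…B6DomainTerm282`,
`…B6DomainMajorant[Sandwich]`, `…B6Expansion282`).  Source: doi:10.1007/bf01240221, held
`paper:balaban1984-cmp96-propagators-rt-ii`; journal page = PDF page + 222; the quotations below were read from the
page renders `b2b-balaban-ref1/pages/1984-cmp96-propagators-rt-II/1984-cmp96-propagators-rt-II-p007-x2.png` (p. 229),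
`…-p013-x2.png` (p. 235), `…-p015-x2.png` (p. 237) and `…-p016-x2.png` (p. 238) AS IMAGES.  Kernel twin of the hand
certification GAPS C-adv4-40 (unit b2b-balaban-adv4-g14, second reading of (2.82)–(2.87): *"same mechanism as
(2.64)–(2.66)"* with the power bookkeeping (L^{j_□}η)^{−d−4}(L^{j₁}η)^d(L^{j′}η)^{−d} ≤ L^{d+4}(L^jη)^{−4}(L^{j′}η)^{−d});
sibling of `…B6RandomWalk` (the chain (2.63)–(2.66) of Prop. 2.2 with the PRINTED constant c₁(α), surge node prover
#8), `…B6Expansion282` (the identity (2.82) X·C = I − R and the commutator family), `…B6Ineq283` (the family □ ≠ □′),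
`…B6DomainMajorantSandwich` (the family G′(□̃)² − G′²), `…B6Cor28` (composition (2.88), which lists *"the Neumann
bookkeeping (2.86) ⇒ (2.87) of Prop. 2.3"* as not reproduced) and `…QGQInverse` (the Sect. C analogue (3.132) of B9 by
coercivity); cell rows GAPS C-b06g11-1, DIVERGENCE D-b06.23; journal claim PROP23-NEUMANN-CHAIN.

THE PRINTED TEXT.  p. 229 [PDF 7], verbatim: *"We cover B^j(Λ_j) by a sum of cubes □ of the size 2ML^jη, each cube
being a sum of 2^d big blocks with a center y ∈ Λ_j (more exactly it belongs to the boundary of this set also). Taking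
these covers for all j from 0 to k we get a family 𝒟 of cubes □ of different sizes and such that T_η = ⋃_{□∈𝒟} □.
… We construct also the corresponding family of functions h described in (1.118), and rescale them to proper scales.
They satisfy Σ_{□∈𝒟} h_□² = 1. (2.36)"*.  p. 235 [PDF 13], verbatim: *"⟨λ, λ′⟩ = Σ_{j=0}^k Σ_{y∈Λ_j} (L^jη)^d λ(y)λ′(y).
(2.69)"* … *"Now we will consider the operator (Q′G′²Q′*)⁻¹. Of course the operator Q′G′²Q′* is positive definite, so
its inverse is well defined. We will construct it and investigate its properties using again a random walk expansion.
Our considerations are analogous to Sect. 5 of [3], concerning unit lattice operators. … The inverse operator is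
constructed by taking an approximate inverse and then solving an exact equation."* … *"C_□ = ((Q′G′(□̃)²Q′*)↾_□)⁻¹,
C = Σ_{□∈𝒟} h_□C_□h_□. (2.70) At first let us find bounds on C_□. We assume that either □̃ ⊂ B^j(Λ_j), or it intersects
B^{j+1}(Λ_{j+1}) also."*  p. 237 [PDF 15], verbatim: *"|C_□(y, y′)| ≤ O(1)(L^jη)^{−d−4}e^{−δ₁(L^jη)^{−1}|y−y′|},
y, y′ ∈ 𝔅∩□. (2.81)"* … *"= I − Σ_{□,□′} R_{□,□′}C_{□′}h_{□′} = I − R, (2.82) with an obvious definition of the operators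
R_{□,□′}. We have to estimate the norm of R in the space L²(𝔅)."*  p. 238 [PDF 16], verbatim: *"so for M large enough the
norm is small. Similar inequalities hold for kernels of the other operators forming R … Now we can estimate the norm of
R either using the estimates of the type (2.84), or using an estimate of the kernel R(y, y′) of the operator R following
from all the partial estimates of the type (2.83). It can be written as |R(y, y′)| ≤ O(M⁻¹)e^{−δ₁d(y,y′)}(L^{j′}η)^{−d},
y, y′ ∈ 𝔅, y′ ∈ Λ_{j′}, (2.85) and by Lemma 2.1 we get* **Proposition 2.3.** *An inverse of the operator Q′G′²Q′* is
given by the convergent expansion (Q′G′²Q′*)⁻¹ = C(I − R)⁻¹ = Σ_{n=0}^∞ CRⁿ = Σ_ω h_{□₀}C_{□₀}h_{□₀}R_{□₁,□₂}C_{□₂}h_{□₂}·…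
·R_{□_{2n−1},□_{2n}}C_{□_{2n}}h_{□_{2n}}, (2.86) and it satisfies the estimate |(Q′G′²Q′*)⁻¹(y, y′)| ≤
O(1)(L^jη)^{−4}(L^{j′}η)^{−d}e^{−½δ₁d(y,y′)} y, y′ ∈ 𝔅, y ∈ Λ_j, y′ ∈ Λ_{j′}. (2.87)"*  Lemma 2.1 (p. 234 [PDF 12]) with
its four displays (2.60)–(2.63) is typed in `…B6RandomWalk` / `…B6Lemma21Repaired` (generic constant).

THE TYPING.  Operators on L²(𝔅) are linear maps `Module.End ℝ (𝔅 → ℝ)` on the finite site type of the abstract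
multiscale carrier `g : B6.Geometry` of `…B6` (𝔅 = `g.Site`, j = `g.scale`, d(·,·) = `g.dist`, L^jη = `g.len`).  The
MATRIX ENTRY `mat T y y′ = T(δ_{y′})(y)` of an operator in the basis of point masses is (L^{j′}η)^d times its kernel
T(y, y′) in the pairing (2.69) (`mat_kerOp`: the operator `B6Expansion282.kerOp w K` with kernel K and weights
w(y″) = (L^{j″}η)^d has matrix w(y′)K(y, y′)); so the printed shape (2.85) *"|R(y,y′)| ≤ O(M⁻¹)e^{−δ₁d(y,y′)}(L^{j′}η)^{−d}"*
is |mat R y y′| ≤ θe^{−δ₁d(y,y′)}, and (2.87) is |mat G y y′| ≤ O(1)(L^jη)^{−4}e^{−½δ₁d(y,y′)} (`kernel_bound_287` converts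
back, dividing by the weight).  The block-majorant language of `…B6RandomWalk` (`HasMajorant blk T K`: *"|(Tλ)(x)| ≤
K(y,y′)|λ|, x ∈ B^j(y), supp λ ⊂ B^{j′}(y′)"*) specialises on 𝔅 itself (blk = id: every site its own block) to exactly
these matrix bounds (`hasMajorant_id_iff`) — this is the dictionary under which *"by Lemma 2.1"* means: the chain
(2.63)–(2.66) of Prop. 2.2, run on 𝔅 at the rate δ₁ of (2.81)/(2.85).  The constant of (2.61) is GENERIC (`c`, with
`B6Lemma21Repaired.Ineq261With c g δ₁ α` / `Ineq263With`): the printed c₁(α) is refuted as typed for d ≥ 3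
(`B6Lemma21Counterexample`, GAPS G-A11-1) and every consumer of the lineage binds the generic form; §1 therefore re-runs
the four steps of `…B6RandomWalk` ((2.64)–(2.66)) verbatim with `c` in place of `B6.c1` (no new idea; the printed-constant
instances are the sibling's).  The cubes □ ∈ 𝒟 are a finite index type D, h_□ = `mulOp (hf □)`, □ = `mulOp (pf □)`
(characteristic function), C_□ = `kerOp w (Ck □)`; the FINITE OVERLAP of the cover (at most n₀ functions h_□ are
non-zero at a site — a property of the construction (2.35)–(2.36)/(1.118) [B5], not printed as a number) is the
hypothesis `hover` with n₀ FREE; the cube scale j(□) (*"connected with a L^jη-scale"*) is `js □` with the support fact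
`g.scale y ≤ js □ + 1` on supp h_□ (p. 235, p. 238) as hypothesis.  (2.81) enters in the d-decaying form
|C_□(y,y′)| ≤ B_C(L^{j_□}η)^{−d−4}e^{−δ₁d(y,y′)} on supp h_□ × supp h_□ (the comparison of the straight contour
(L^jη)^{−1}|y − y′| with d(y, y′) inside one cube is the located input of `…B6Ineq283` / `…B6Expansion282`, hypothesis
`hρ` there; not re-adjudicated here).

WHAT THIS MODULE PROVES (kernel-checked; no `sorry`, no axiom beyond Lean's three; every analytic input a hypothesis
of the printed shape with FREE constants):
1. `majorant_pow_265W`, `majorant_G0_mul_265W`, `majorant_partialSum_266W`, `majorant_of_fixedPoint_266W` — the chain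
   (2.64)–(2.66) of `…B6RandomWalk` with a generic (2.61)/(2.63) constant c ≥ 0 (statements and proofs otherwise
   identical to the sibling's printed-constant ones).
2. `mat` (= Mathlib's `LinearMap.toMatrix'` entrywise, `mat_eq_toMatrix'`), `apply_eq_sum_mat`, `mat_mul`, `mat_sum`,
   `mat_kerOp`, `mat_mul_mulOp`, `mat_mulOp_mul`, `hasMajorant_id_iff` — the dictionary operators ↔ matrices ↔ kernels in (2.69) ↔ block majorants with blk = id.
3. `neumann_majorant` — *"by Lemma 2.1"*: if G = C + G·R on 𝔅 (finite), |mat C y y′| ≤ A·P(y)e^{−δ₁d(y,y′)},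
   |mat R y y′| ≤ θe^{−δ₁d(y,y′)}, (2.61) and (2.63) at rate δ₁ with constant c, and θc < 1, then
   |mat G y y′| ≤ A c (1 − θc)⁻¹ P(y) e^{−(1−α)δ₁d(y,y′)} — (2.87) in matrix form with its O(1) explicit.
4. `rowSum_le`, `eq_zero_of_fixed`, `isUnit_one_sub`, `inverse_exists_unique` — EXISTENCE: from X·C = 1 − R (the identity
   (2.82), `B6Expansion282.expansion282`) and the row-sum bound Σ_{y′}|mat R y y′| ≤ θc < 1 (which (2.85) + (2.61) give,
   `rowSum_le`): 1 − R is invertible (a fixed vector of R vanishes at its maximal site), X is invertible with the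
   two-sided inverse G = C(1 − R)⁻¹, G = C + G·R, and the left inverse of X is unique — the content of *"An inverse of
   the operator Q′G′²Q′* is given by the convergent expansion (Q′G′²Q′*)⁻¹ = C(I − R)⁻¹"* on the finite set 𝔅 WITHOUT
   using positive definiteness.
5. `prop23_matrix`, `kernel_bound_287`, `prop23_kernel_287` — the assembled statement: under 3's hypotheses and X·C = 1 − R there is a unique
   two-sided inverse G of X with the bound of 3, and in the pairing (2.69) (weights (L^{j′}η)^d, P(y) = (L^jη)^{−4},
   α = ½) its kernel obeys literally *"|(Q′G′²Q′*)⁻¹(y,y′)| ≤ O(1)(L^jη)^{−4}(L^{j′}η)^{−d}e^{−½δ₁d(y,y′)}"* with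
   O(1) = A c(1 − θc)⁻¹ (`prop23_kernel_287`, in the real-power shape of the kernel clause of `B6.Prop23Printed`).
6. `pairSum_abs_le`, `mat_R282_abs_le` — THE ASSEMBLY OF (2.85) *"following from all the partial estimates of the
   type (2.83)"*: if every diagonal term R_{□,□}C_□h_□ has matrix bounded by ε_d·E(y,y′) and every term R_{□,□′}C_{□′}h_{□′},
   □ ≠ □′, by ε_o·E(y,y′), then — because the former vanishes unless h_□(y′) ≠ 0 and the latter unless h_□(y) ≠ 0 and
   h_{□′}(y′) ≠ 0 (PROVED from the operator structure of `B6Expansion282.R282`/`Rpair`, the last factor h_{□′} and the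
   leading factor (□′ − 1)h_□²) — |mat R y y′| ≤ (n₀ε_d + n₀²ε_o)·E(y,y′): with E = e^{−δ₁d} this is (2.85) with
   θ = n₀ε_d + n₀²ε_o; `theta_le_inv_M` — with the sizes proved in the siblings (ε_d = κ₂/M + κ₃e^{−c₃M}: commutator
   family `B6Expansion282.line2Ker_abs_le_285` and domain family `B6DomainMajorantSandwich`; ε_o = κ₄e^{−c₄M}:
   `B6Ineq283`) θ ≤ K/M with K = n₀(κ₂ + κ₃/(e c₃)) + n₀²κ₄/(e c₄): the printed *"O(M⁻¹)"*; `smallness_of_M_large` —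
   *"for M large enough"*: M ≥ 2Kc gives θc ≤ ½ and (1 − θc)⁻¹ ≤ 2.
7. `scale_bookkeeping`, `len_le_of_scale_le`, `mat_piece`, `mat_Cglued_abs_le` — the majorant of C = Σ_□ h_□C_□h_□ from (2.81), |h_□| ≤ 1, the finite overlap
   and the one-cube scale facts: |mat C y y′| ≤ n₀B_C L^{d+4}(L^jη)^{−4}e^{−δ₁d(y,y′)} — the hypothesis of 3 with
   A = n₀B_C L^{d+4}, P(y) = (L^jη)^{−4} (C-adv4-40's power bookkeeping, kernel-checked).
WHAT IT DOES NOT PROVE: the per-term bounds themselves (they are the siblings' theorems under their own located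
hypotheses — in particular the Lipschitz constant s of h_□ (GAPS C-b06g10-1 (r1)), the straight-contour comparison, and
(2.81) itself (= (2.79) via *"Sect. 5 [3]"*, GAPS G-B6-05) stay exactly as located there); the finite-overlap number n₀
and the support/scale facts of the cover (2.35)–(2.36) (free hypotheses); the identity X·C = 1 − R is IMPORTED as a
hypothesis shape (proved in `B6Expansion282.expansion282` from □h_□ = h_□, (2.36), (2.70)); the path expansion over ω in
(2.86) (only Σ_n CRⁿ / the fixed point is used); the L²(𝔅)-norm route (2.84); positive definiteness of Q′G′²Q′* (not
needed on the finite set).  Value = kernel certificate of the printed Neumann paragraph of Prop. 2.3 with every O(·)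
explicit in the free constants, NOT summit progress.
v1.1 (re p183352 `dedup.landed`): the folklore lemma `len_pos` (0 < L^jη) is NOT restated — it has landed as
`B11KernelDictionary.len_pos`; its one-line proof is inlined locally (no import of that B9/B11-chain module); no
statement of this file changed.
-/

namespace Literature.MathematicalPhysics.QuantumFieldTheory.Balaban1983to89.B6Prop23Chain

open Literature.MathematicalPhysics.QuantumFieldTheory.Balaban1983to89
open Finset B6RandomWalk B6Lemma21Repaired B6Expansion282

/-! ## §1. The chain (2.64)–(2.66) of Lemma 2.1 / Prop. 2.2 with a GENERIC (2.61)-constant -/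

section GenericChain

variable {g : B6.Geometry} {X : Type}

/-- (2.64) ⇒ (2.65) with a generic constant: from the majorant θe^{−δ₀d} of R and (2.63) with constant c,
Rⁿ has majorant (θc)ⁿe^{−(1−α)δ₀d(y,y′)} (n = 0 uses d(y,y) = 0).  Verbatim the sibling's `majorant_pow_265` with `c`
for c₁(α). [cite: Balaban1984PropagatorsII, (2.64)–(2.65) p.234] -/
theorem majorant_pow_265W (blk : X → g.Site) (c δ₀ α θ : ℝ) (hθ : 0 ≤ θ)
    (hrefl : ∀ y : g.Site, g.dist y y = 0) (h263 : Ineq263With c g δ₀ α)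
    {R : Module.End ℝ (X → ℝ)} (hR : HasMajorant blk R (fun a b => θ * Real.exp (-(δ₀ * g.dist a b)))) (n : ℕ) :
    HasMajorant blk (R ^ n) (fun a b => (θ * c) ^ n * Real.exp (-((1 - α) * δ₀ * g.dist a b))) := by
  cases n with
  | zero =>
      intro y' μ B hμ x
      by_cases hx : blk x = y'
      · simpa [hx, hrefl y'] using hμ.bound x hx
      · simp only [pow_zero, Module.End.one_apply, hμ.off x hx, abs_zero]
        exact mul_nonneg (by positivity) hμ.nonneg
  | succ m =>
      have hK : ∀ a b : g.Site, 0 ≤ θ * Real.exp (-(δ₀ * g.dist a b)) := fun a b =>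
        mul_nonneg hθ (Real.exp_nonneg _)
      refine hasMajorant_mono blk (hasMajorant_pow_chain blk hR hK m) fun a b => ?_
      rw [chain_const_mul, mul_pow, mul_assoc]
      exact mul_le_mul_of_nonneg_left (h263 m a b) (pow_nonneg hθ _)

/-- One term of (2.66) with a generic constant: G₀T with majorants A·P(y)e^{−δ₀d} and r·e^{−(1−α)δ₀d} has majorant
A c P(y) r e^{−(1−α)δ₀d(y,y′)} ((2.54) + (2.61) with constant c).  Verbatim the sibling's `majorant_G0_mul_265`.
[cite: Balaban1984PropagatorsII, (2.66) p.234] -/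
theorem majorant_G0_mul_265W (blk : X → g.Site) (c δ₀ α A r : ℝ) (P : g.Site → ℝ) (hA : 0 ≤ A)
    (hP : ∀ y, 0 ≤ P y) (hr : 0 ≤ r) (hαδ : 0 ≤ (1 - α) * δ₀) (htri : Triangle254 g) (h261 : Ineq261With c g δ₀ α)
    {G0 T : Module.End ℝ (X → ℝ)}
    (hG0 : HasMajorant blk G0 (fun a b => A * P a * Real.exp (-(δ₀ * g.dist a b))))
    (hT : HasMajorant blk T (fun a b => r * Real.exp (-((1 - α) * δ₀ * g.dist a b)))) :
    HasMajorant blk (G0 * T)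
      (fun a b => A * c * P a * r * Real.exp (-((1 - α) * δ₀ * g.dist a b))) := by
  have hK₂ : ∀ a b : g.Site, 0 ≤ r * Real.exp (-((1 - α) * δ₀ * g.dist a b)) := fun a b =>
    mul_nonneg hr (Real.exp_nonneg _)
  refine hasMajorant_mono blk (hasMajorant_mul blk hG0 hT hK₂) fun a b => ?_
  have hterm : ∀ y'' : g.Site,
      A * P a * Real.exp (-(δ₀ * g.dist a y'')) * (r * Real.exp (-((1 - α) * δ₀ * g.dist y'' b))) ≤
        A * P a * r * Real.exp (-((1 - α) * δ₀ * g.dist a b)) * Real.exp (-(α * δ₀ * g.dist a y'')) := by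
    intro y''
    have hexp : Real.exp (-(δ₀ * g.dist a y'')) * Real.exp (-((1 - α) * δ₀ * g.dist y'' b)) ≤
        Real.exp (-((1 - α) * δ₀ * g.dist a b)) * Real.exp (-(α * δ₀ * g.dist a y'')) := by
      rw [← Real.exp_add, ← Real.exp_add]
      refine Real.exp_le_exp.mpr ?_
      have := mul_le_mul_of_nonneg_left (htri a y'' b) hαδ
      nlinarith
    have := mul_le_mul_of_nonneg_left hexp (mul_nonneg (mul_nonneg hA (hP a)) hr)
    calc A * P a * Real.exp (-(δ₀ * g.dist a y'')) * (r * Real.exp (-((1 - α) * δ₀ * g.dist y'' b)))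
        = A * P a * r * (Real.exp (-(δ₀ * g.dist a y'')) * Real.exp (-((1 - α) * δ₀ * g.dist y'' b))) := by ring
      _ ≤ A * P a * r * (Real.exp (-((1 - α) * δ₀ * g.dist a b)) * Real.exp (-(α * δ₀ * g.dist a y''))) := this
      _ = _ := by ring
  calc ∑ y'' : g.Site, A * P a * Real.exp (-(δ₀ * g.dist a y'')) * (r * Real.exp (-((1 - α) * δ₀ * g.dist y'' b)))
      ≤ ∑ y'' : g.Site, A * P a * r * Real.exp (-((1 - α) * δ₀ * g.dist a b)) *
          Real.exp (-(α * δ₀ * g.dist a y'')) := Finset.sum_le_sum fun y'' _ => hterm y''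
    _ = A * P a * r * Real.exp (-((1 - α) * δ₀ * g.dist a b)) *
          ∑ y'' : g.Site, Real.exp (-(α * δ₀ * g.dist a y'')) := by rw [Finset.mul_sum]
    _ ≤ A * P a * r * Real.exp (-((1 - α) * δ₀ * g.dist a b)) * c :=
        mul_le_mul_of_nonneg_left (h261 a)
          (mul_nonneg (mul_nonneg (mul_nonneg hA (hP a)) hr) (Real.exp_nonneg _))
    _ = A * c * P a * r * Real.exp (-((1 - α) * δ₀ * g.dist a b)) := by ring

/-- The partial sums of (2.66) with a generic constant: Σ_{n<N} G₀Rⁿ has majorant A c (1 − θc)⁻¹ P(y) e^{−(1−α)δ₀d(y,y′)}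
uniformly in N, under θc < 1.  Verbatim the sibling's `majorant_partialSum_266`. [cite: Balaban1984PropagatorsII, (2.66) p.234] -/
theorem majorant_partialSum_266W (blk : X → g.Site) (c δ₀ α θ A : ℝ) (P : g.Site → ℝ) (hA : 0 ≤ A)
    (hP : ∀ y, 0 ≤ P y) (hθ : 0 ≤ θ) (hc : 0 ≤ c) (hαδ : 0 ≤ (1 - α) * δ₀) (htri : Triangle254 g)
    (hrefl : ∀ y : g.Site, g.dist y y = 0) (h261 : Ineq261With c g δ₀ α) (h263 : Ineq263With c g δ₀ α)
    (hsmall : θ * c < 1) {G0 R : Module.End ℝ (X → ℝ)}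
    (hG0 : HasMajorant blk G0 (fun a b => A * P a * Real.exp (-(δ₀ * g.dist a b))))
    (hR : HasMajorant blk R (fun a b => θ * Real.exp (-(δ₀ * g.dist a b)))) (N : ℕ) :
    HasMajorant blk (∑ n ∈ Finset.range N, G0 * R ^ n)
      (fun a b => A * c * (1 - θ * c)⁻¹ * P a * Real.exp (-((1 - α) * δ₀ * g.dist a b))) := by
  set q : ℝ := θ * c with hq
  have hq0 : 0 ≤ q := mul_nonneg hθ hc
  have hterm : ∀ n, HasMajorant blk (G0 * R ^ n)
      (fun a b => A * c * P a * q ^ n * Real.exp (-((1 - α) * δ₀ * g.dist a b))) := fun n =>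
    majorant_G0_mul_265W blk c δ₀ α A (q ^ n) P hA hP (pow_nonneg hq0 n) hαδ htri h261 hG0
      (majorant_pow_265W blk c δ₀ α θ hθ hrefl h263 hR n)
  refine hasMajorant_mono blk (hasMajorant_sum blk (fun n => G0 * R ^ n) _ hterm N) fun a b => ?_
  have hgeom : ∑ n ∈ Finset.range N, q ^ n ≤ (1 - q)⁻¹ :=
    sum_le_hasSum (Finset.range N) (fun n _ => pow_nonneg hq0 n) (hasSum_geometric_of_lt_one hq0 hsmall)
  have hC : 0 ≤ A * c * P a * Real.exp (-((1 - α) * δ₀ * g.dist a b)) :=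
    mul_nonneg (mul_nonneg (mul_nonneg hA hc) (hP a)) (Real.exp_nonneg _)
  calc ∑ n ∈ Finset.range N, A * c * P a * q ^ n * Real.exp (-((1 - α) * δ₀ * g.dist a b))
      = A * c * P a * Real.exp (-((1 - α) * δ₀ * g.dist a b)) * ∑ n ∈ Finset.range N, q ^ n := by
        rw [Finset.mul_sum]; refine Finset.sum_congr rfl fun n _ => ?_; ring
    _ ≤ A * c * P a * Real.exp (-((1 - α) * δ₀ * g.dist a b)) * (1 - q)⁻¹ :=
        mul_le_mul_of_nonneg_left hgeom hC
    _ = _ := by ring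

/-- (2.66) for the operator itself, generic constant: any G′ with G′ = G₀ + G′R on a finite lattice has majorant
A c (1 − θc)⁻¹ P(y) e^{−(1−α)δ₀d(y,y′)} (the remainder G′R^N dies as N → ∞).  Verbatim the sibling's
`majorant_of_fixedPoint_266`. [cite: Balaban1984PropagatorsII, Prop. 2.2 (2.66)–(2.67) p.234] -/
theorem majorant_of_fixedPoint_266W [Fintype X] [DecidableEq X] (blk : X → g.Site) (c δ₀ α θ A : ℝ)
    (P : g.Site → ℝ) (hA : 0 ≤ A) (hP : ∀ y, 0 ≤ P y) (hθ : 0 ≤ θ) (hc : 0 ≤ c) (hαδ : 0 ≤ (1 - α) * δ₀)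
    (htri : Triangle254 g) (hrefl : ∀ y : g.Site, g.dist y y = 0) (hdnn : ∀ y y' : g.Site, 0 ≤ g.dist y y')
    (h261 : Ineq261With c g δ₀ α) (h263 : Ineq263With c g δ₀ α) (hsmall : θ * c < 1)
    {G' G0 R : Module.End ℝ (X → ℝ)}
    (hG0 : HasMajorant blk G0 (fun a b => A * P a * Real.exp (-(δ₀ * g.dist a b))))
    (hR : HasMajorant blk R (fun a b => θ * Real.exp (-(δ₀ * g.dist a b)))) (hfix : G' = G0 + G' * R) :
    HasMajorant blk G'
      (fun a b => A * c * (1 - θ * c)⁻¹ * P a * Real.exp (-((1 - α) * δ₀ * g.dist a b))) := by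
  intro y' μ B hμ x
  obtain ⟨E, hE, hEb⟩ := exists_opBound G'
  set q : ℝ := θ * c with hq
  have hq0 : 0 ≤ q := mul_nonneg hθ hc
  set C : ℝ := A * c * (1 - q)⁻¹ * P (blk x) * Real.exp (-((1 - α) * δ₀ * g.dist (blk x) y')) * B with hC
  have hN : ∀ N : ℕ, |G' μ x| ≤ C + E * B * q ^ N := by
    intro N
    have hS := majorant_partialSum_266W blk c δ₀ α θ A P hA hP hθ hc hαδ htri hrefl h261 h263 hsmall hG0 hR N
      y' μ B hμ x
    have hRN := majorant_pow_265W blk c δ₀ α θ hθ hrefl h263 hR N y' μ B hμ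
    have hsup : ∀ z, |(R ^ N) μ z| ≤ q ^ N * B := fun z => by
      refine (hRN z).trans ?_
      refine mul_le_mul_of_nonneg_right ?_ hμ.nonneg
      have : Real.exp (-((1 - α) * δ₀ * g.dist (blk z) y')) ≤ 1 := by
        rw [Real.exp_le_one_iff]
        have := mul_nonneg hαδ (hdnn (blk z) y')
        linarith
      simpa [hq] using mul_le_mul_of_nonneg_left this (pow_nonneg hq0 N)
    have hrem : |(G' * R ^ N) μ x| ≤ E * (q ^ N * B) := by
      rw [Module.End.mul_apply]
      exact hEb _ _ (mul_nonneg (pow_nonneg hq0 N) hμ.nonneg) hsup x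
    have hsplit : G' μ x = (∑ n ∈ Finset.range N, G0 * R ^ n) μ x + (G' * R ^ N) μ x := by
      conv_lhs => rw [fixedPoint_telescope hfix N]
      rfl
    rw [hsplit]
    refine (abs_add_le _ _).trans ?_
    have h1 : |(∑ n ∈ Finset.range N, G0 * R ^ n) μ x| ≤ C := by simpa [hC, hq] using hS
    nlinarith [hrem, h1]
  have hlim : Filter.Tendsto (fun N : ℕ => C + E * B * q ^ N) Filter.atTop (nhds (C + E * B * 0)) :=
    ((tendsto_pow_atTop_nhds_zero_of_lt_one hq0 hsmall).const_mul (E * B)).const_add C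
  rw [mul_zero, add_zero] at hlim
  have := ge_of_tendsto' hlim hN
  simpa [hC, hq] using this

end GenericChain

/-! ## §2. Operators on 𝔅 ↔ matrices ↔ kernels in the pairing (2.69) ↔ block majorants with blk = id -/

section Matrices

variable {S : Type} [DecidableEq S]

/-- The matrix entry of an operator in the basis of point masses: `mat T y y′ = T(δ_{y′})(y)`.  For the operator with
kernel K in the pairing (2.69) this is (L^{j′}η)^d K(y, y′) (`mat_kerOp`). [cite: Balaban1984PropagatorsII, (2.69) p.235] -/
def mat (T : Module.End ℝ (S → ℝ)) (y y' : S) : ℝ := T (Pi.single y' 1) y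

/-- Matrices add. [folklore] -/
theorem mat_add (T₁ T₂ : Module.End ℝ (S → ℝ)) (y y' : S) :
    mat (T₁ + T₂) y y' = mat T₁ y y' + mat T₂ y y' := rfl

/-- Matrices subtract. [folklore] -/
theorem mat_sub (T₁ T₂ : Module.End ℝ (S → ℝ)) (y y' : S) :
    mat (T₁ - T₂) y y' = mat T₁ y y' - mat T₂ y y' := rfl

/-- Matrix of a finite sum of operators. [folklore] -/
theorem mat_sum {ι : Type} (s : Finset ι) (T : ι → Module.End ℝ (S → ℝ)) (y y' : S) :
    mat (∑ i ∈ s, T i) y y' = ∑ i ∈ s, mat (T i) y y' := by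
  unfold mat
  rw [LinearMap.sum_apply, Finset.sum_apply]

/-- The multiplication operator h maps δ_{y′} to h(y′)δ_{y′}. [folklore] -/
theorem mulOp_single (f : S → ℝ) (y' : S) :
    mulOp f (Pi.single y' 1) = f y' • (Pi.single y' (1 : ℝ) : S → ℝ) := by
  funext z
  by_cases hz : z = y'
  · subst hz; simp [mulOp_apply]
  · simp [mulOp_apply, hz]

/-- A multiplication operator on the RIGHT multiplies the matrix column y′ by h(y′) (so T·h_□ has entries vanishing
where h_□(y′) = 0). [folklore] -/
theorem mat_mul_mulOp (T : Module.End ℝ (S → ℝ)) (f : S → ℝ) (y y' : S) :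
    mat (T * mulOp f) y y' = mat T y y' * f y' := by
  unfold mat
  rw [Module.End.mul_apply, mulOp_single, map_smul, Pi.smul_apply, smul_eq_mul, mul_comm]

/-- A multiplication operator on the LEFT multiplies the matrix row y by h(y). [folklore] -/
theorem mat_mulOp_mul (f : S → ℝ) (T : Module.End ℝ (S → ℝ)) (y y' : S) :
    mat (mulOp f * T) y y' = f y * mat T y y' := by
  unfold mat
  rw [Module.End.mul_apply, mulOp_apply]

/-- Row vanishing of the off-diagonal operators: ((□′ − 1)h_□² · Y)(y, ·) carries the factor h_□(y)². [folklore] -/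
theorem mat_offDiag_row (pf' hf : S → ℝ) (Y : Module.End ℝ (S → ℝ)) (y y' : S) :
    mat ((mulOp pf' - 1) * (mulOp hf * mulOp hf) * Y) y y' = (pf' y - 1) * (hf y * hf y) * mat Y y y' := by
  unfold mat
  simp only [Module.End.mul_apply, LinearMap.sub_apply, Module.End.one_apply, mulOp_apply, Pi.sub_apply]
  ring

variable [Fintype S]

/-- `mat` is Mathlib's `LinearMap.toMatrix'`, entrywise. [folklore] -/
theorem mat_eq_toMatrix' (T : Module.End ℝ (S → ℝ)) (y y' : S) :
    mat T y y' = LinearMap.toMatrix' T y y' := rfl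

/-- Expansion in point masses: (Tμ)(y) = Σ_{y′} mat T y y′ · μ(y′). [folklore] -/
theorem apply_eq_sum_mat (T : Module.End ℝ (S → ℝ)) (μ : S → ℝ) (y : S) :
    T μ y = ∑ y', mat T y y' * μ y' := by
  have hdec : μ = ∑ y' : S, μ y' • (Pi.single y' (1 : ℝ) : S → ℝ) := by
    funext z
    rw [Finset.sum_apply]
    simp [Pi.single_apply]
  conv_lhs => rw [hdec, map_sum, Finset.sum_apply]
  refine Finset.sum_congr rfl fun y' _ => ?_
  rw [map_smul, Pi.smul_apply, smul_eq_mul, mul_comm]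
  rfl

/-- Matrices multiply: mat (T₁T₂) = mat T₁ · mat T₂. [folklore] -/
theorem mat_mul (T₁ T₂ : Module.End ℝ (S → ℝ)) (y y' : S) :
    mat (T₁ * T₂) y y' = ∑ z, mat T₁ y z * mat T₂ z y' := by
  show (T₁ * T₂) (Pi.single y' 1) y = _
  rw [Module.End.mul_apply, apply_eq_sum_mat]
  rfl

/-- The operator `kerOp w K` (kernel K in the pairing with weights w) has matrix w(y′)K(y, y′).
[cite: Balaban1984PropagatorsII, (2.69) p.235] -/
theorem mat_kerOp (w : S → ℝ) (K : S → S → ℝ) (y y' : S) : mat (kerOp w K) y y' = w y' * K y y' := by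
  unfold mat
  rw [kerOp_apply]
  simp [Pi.single_apply]

/-- Every entry is bounded by its row sum of absolute values. [folklore] -/
theorem abs_apply_le_rowSum (T : Module.End ℝ (S → ℝ)) (μ : S → ℝ) (y : S) {B : ℝ} (hμ : ∀ y', |μ y'| ≤ B) :
    |T μ y| ≤ (∑ y', |mat T y y'|) * B := by
  rw [apply_eq_sum_mat, Finset.sum_mul]
  refine (Finset.abs_sum_le_sum_abs _ _).trans (Finset.sum_le_sum fun y' _ => ?_)
  rw [abs_mul]
  exact mul_le_mul_of_nonneg_left (hμ y') (abs_nonneg _)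

end Matrices

section Dictionary

variable {g : B6.Geometry} [DecidableEq g.Site]

/-- The point mass δ_{y′} is supported in the block {y′} of blk = id with sup 1. [folklore] -/
theorem blockSupp_single (y' : g.Site) : BlockSupp (id : g.Site → g.Site) (Pi.single y' (1 : ℝ)) y' 1 :=
  ⟨zero_le_one, fun x (hx : x = y') => by subst hx; simp, fun x (hx : x ≠ y') => by simp [hx]⟩

/-- THE DICTIONARY: on 𝔅 itself (every site its own block, blk = id) the block-majorant statement of `…B6RandomWalk`,
*"|(Tλ)(x)| ≤ K(y, y′)|λ| for x ∈ B(y), supp λ ⊂ B(y′)"*, is exactly the entrywise matrix bound |mat T y y′| ≤ K(y, y′).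
[cite: Balaban1984PropagatorsII, (2.51) p.232 + (2.85) p.238] -/
theorem hasMajorant_id_iff (T : Module.End ℝ (g.Site → ℝ)) (K : g.Site → g.Site → ℝ) :
    HasMajorant (id : g.Site → g.Site) T K ↔ ∀ y y', |mat T y y'| ≤ K y y' := by
  constructor
  · intro h y y'
    simpa [mat] using h y' (Pi.single y' 1) 1 (blockSupp_single y') y
  · intro h y' μ B hμ x
    have hμeq : μ = μ y' • (Pi.single y' (1 : ℝ) : g.Site → ℝ) := by
      funext z
      by_cases hz : z = y'
      · subst hz; simp
      · simp [hz, hμ.off z hz]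
    rw [hμeq, map_smul, Pi.smul_apply, smul_eq_mul, abs_mul]
    calc |μ y'| * |T (Pi.single y' 1) x| ≤ B * K x y' :=
          mul_le_mul (hμ.bound y' rfl) (h x y') (abs_nonneg _) hμ.nonneg
      _ = K (id x) y' * B := by rw [mul_comm]; rfl

end Dictionary

/-! ## §3. "by Lemma 2.1": the Neumann chain (2.86) ⇒ (2.87) in matrix form on 𝔅 -/

section Neumann

variable {g : B6.Geometry} [DecidableEq g.Site]

/-- **(2.85) + Lemma 2.1 ⇒ (2.87), matrix form.**  On 𝔅 (finite), if G = C + G·R, |mat C y y′| ≤ A·P(y)e^{−δ₁d(y,y′)}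
(the glued (2.81), `mat_Cglued_abs_le`), |mat R y y′| ≤ θe^{−δ₁d(y,y′)} ((2.85): θ = O(M⁻¹), the weight (L^{j′}η)^d of
(2.69) absorbing the printed (L^{j′}η)^{−d}), (2.61)/(2.63) at rate δ₁ with constant c and θc < 1, then
|mat G y y′| ≤ A c (1 − θc)⁻¹ P(y) e^{−(1−α)δ₁d(y,y′)} — the sibling's chain (2.64)–(2.66) run with blk = id.
[cite: Balaban1984PropagatorsII, Prop. 2.3 (2.85)–(2.87) p.238] -/
theorem neumann_majorant (c δ₁ α θ A : ℝ) (P : g.Site → ℝ) (hA : 0 ≤ A) (hP : ∀ y, 0 ≤ P y) (hθ : 0 ≤ θ)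
    (hc : 0 ≤ c) (hαδ : 0 ≤ (1 - α) * δ₁) (htri : Triangle254 g) (hrefl : ∀ y : g.Site, g.dist y y = 0)
    (hdnn : ∀ y y' : g.Site, 0 ≤ g.dist y y') (h261 : Ineq261With c g δ₁ α) (h263 : Ineq263With c g δ₁ α)
    (hsmall : θ * c < 1) {G C R : Module.End ℝ (g.Site → ℝ)}
    (hC : ∀ y y', |mat C y y'| ≤ A * P y * Real.exp (-(δ₁ * g.dist y y')))
    (hR : ∀ y y', |mat R y y'| ≤ θ * Real.exp (-(δ₁ * g.dist y y'))) (hfix : G = C + G * R) :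
    ∀ y y', |mat G y y'| ≤ A * c * (1 - θ * c)⁻¹ * P y * Real.exp (-((1 - α) * δ₁ * g.dist y y')) :=
  (hasMajorant_id_iff G _).mp
    (majorant_of_fixedPoint_266W id c δ₁ α θ A P hA hP hθ hc hαδ htri hrefl hdnn h261 h263 hsmall
      ((hasMajorant_id_iff C _).mpr hC) ((hasMajorant_id_iff R _).mpr hR) hfix)

/-- (2.85) + (2.61) give the ROW-SUM bound Σ_{y′}|mat R y y′| ≤ θc (α ≤ 1 in the form 0 ≤ (1−α)δ₁, d ≥ 0): the
smallness of R *"in the space L²(𝔅)"* read in ℓ^∞(𝔅). [cite: Balaban1984PropagatorsII, (2.85) p.238 + (2.61) p.234] -/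
theorem rowSum_le {c δ₁ α θ : ℝ} (hθ : 0 ≤ θ) (hαδ : 0 ≤ (1 - α) * δ₁) (hdnn : ∀ y y' : g.Site, 0 ≤ g.dist y y')
    (h261 : Ineq261With c g δ₁ α) {R : Module.End ℝ (g.Site → ℝ)}
    (hR : ∀ y y', |mat R y y'| ≤ θ * Real.exp (-(δ₁ * g.dist y y'))) :
    ∀ y, ∑ y', |mat R y y'| ≤ θ * c := by
  intro y
  have hstep : ∀ y', θ * Real.exp (-(δ₁ * g.dist y y')) ≤ θ * Real.exp (-(α * δ₁ * g.dist y y')) := fun y' =>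
    mul_le_mul_of_nonneg_left (Real.exp_le_exp.mpr (by nlinarith [mul_nonneg hαδ (hdnn y y')])) hθ
  calc ∑ y', |mat R y y'| ≤ ∑ y', θ * Real.exp (-(α * δ₁ * g.dist y y')) :=
        Finset.sum_le_sum fun y' _ => (hR y y').trans (hstep y')
    _ = θ * ∑ y', Real.exp (-(α * δ₁ * g.dist y y')) := by rw [Finset.mul_sum]
    _ ≤ θ * c := mul_le_mul_of_nonneg_left (h261 y) hθ

end Neumann

/-! ## §4. Existence and uniqueness of the inverse on the finite set 𝔅 -/

section Existence

variable {S : Type} [Fintype S] [DecidableEq S]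

/-- A fixed vector of a strict ℓ^∞-contraction vanishes (look at a site where |μ| is maximal). [folklore] -/
theorem eq_zero_of_fixed {R : Module.End ℝ (S → ℝ)} {q : ℝ} (hq : q < 1) (hrow : ∀ y, ∑ y', |mat R y y'| ≤ q)
    {μ : S → ℝ} (hμ : R μ = μ) : μ = 0 := by
  rcases isEmpty_or_nonempty S with hS | hS
  · funext y; exact (IsEmpty.false y).elim
  · obtain ⟨y₀, -, hy₀⟩ := Finset.exists_max_image Finset.univ (fun y => |μ y|) Finset.univ_nonempty
    have hmax : ∀ y', |μ y'| ≤ |μ y₀| := fun y' => hy₀ y' (Finset.mem_univ y')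
    have hle : |μ y₀| ≤ q * |μ y₀| := by
      calc |μ y₀| = |R μ y₀| := by rw [hμ]
        _ ≤ (∑ y', |mat R y₀ y'|) * |μ y₀| := abs_apply_le_rowSum R μ y₀ hmax
        _ ≤ q * |μ y₀| := mul_le_mul_of_nonneg_right (hrow y₀) (abs_nonneg _)
    have h0 : |μ y₀| = 0 := by nlinarith [abs_nonneg (μ y₀)]
    funext y
    have := hmax y
    rw [h0] at this
    exact abs_eq_zero.mp (le_antisymm this (abs_nonneg _))

/-- I − R is invertible when the row sums of |mat R| are < 1 (finite dimension: injective ⇒ unit).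
[cite: Balaban1984PropagatorsII, (2.86) p.238] -/
theorem isUnit_one_sub {R : Module.End ℝ (S → ℝ)} {q : ℝ} (hq : q < 1) (hrow : ∀ y, ∑ y', |mat R y y'| ≤ q) :
    IsUnit (1 - R) := by
  rw [LinearMap.isUnit_iff_ker_eq_bot, LinearMap.ker_eq_bot']
  intro μ hμ
  have h0 : μ - R μ = 0 := hμ
  exact eq_zero_of_fixed hq hrow (sub_eq_zero.mp h0).symm

/-- **EXISTENCE AND UNIQUENESS** behind *"An inverse of the operator Q′G′²Q′* is given by the convergent expansion
(Q′G′²Q′*)⁻¹ = C(I − R)⁻¹"*: if X·C = 1 − R (the identity (2.82)) and the row sums of |mat R| are ≤ q < 1, then X has a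
unique left inverse G, which is two-sided, equals C(1 − R)⁻¹ and satisfies the fixed-point equation G = C + G·R of
(2.86) — on the finite set 𝔅, with no appeal to positive definiteness. [cite: Balaban1984PropagatorsII, Prop. 2.3 (2.86) p.238] -/
theorem inverse_exists_unique {X C R : Module.End ℝ (S → ℝ)} (hXC : X * C = 1 - R) {q : ℝ} (hq : q < 1)
    (hrow : ∀ y, ∑ y', |mat R y y'| ≤ q) :
    ∃ G : Module.End ℝ (S → ℝ), G * X = 1 ∧ X * G = 1 ∧ G = C + G * R ∧
      ∀ G' : Module.End ℝ (S → ℝ), G' * X = 1 → G' = G := by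
  obtain ⟨u, hu⟩ := isUnit_one_sub hq hrow
  have hXG : X * (C * ↑u⁻¹) = 1 := by rw [← mul_assoc, hXC, ← hu, Units.mul_inv]
  have hGX : C * ↑u⁻¹ * X = 1 := mul_eq_one_comm.mp hXG
  refine ⟨C * ↑u⁻¹, hGX, hXG, ?_, ?_⟩
  · have h1 : C * ↑u⁻¹ * (1 - R) = C := by rw [← hu, mul_assoc, Units.inv_mul, mul_one]
    calc C * ↑u⁻¹ = C * ↑u⁻¹ * (1 - R) + C * ↑u⁻¹ * R := by rw [mul_sub, mul_one, sub_add_cancel]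
      _ = C + C * ↑u⁻¹ * R := by rw [h1]
  · intro G' hG'
    calc G' = G' * (X * (C * ↑u⁻¹)) := by rw [hXG, mul_one]
      _ = C * ↑u⁻¹ := by rw [← mul_assoc, hG', one_mul]

end Existence

/-! ## §5. Proposition 2.3 assembled; the kernel bound (2.87) in the pairing (2.69) -/

section ScaleFacts

variable {g : B6.Geometry}

/-- x^{−4} as a real power is (x⁴)⁻¹ for x ≥ 0. [folklore] -/
theorem rpow_neg_four {x : ℝ} (hx : 0 ≤ x) : x ^ (-(4 : ℝ)) = (x ^ 4)⁻¹ := by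
  rw [Real.rpow_neg hx, show (4 : ℝ) = ((4 : ℕ) : ℝ) by norm_num, Real.rpow_natCast]

/-- x^{−d} as a real power is (x^d)⁻¹ for x ≥ 0. [folklore] -/
theorem rpow_neg_natCast' {x : ℝ} (hx : 0 ≤ x) (d : ℕ) : x ^ (-(d : ℝ)) = (x ^ d)⁻¹ := by
  rw [Real.rpow_neg hx, Real.rpow_natCast]

-- (L^jη > 0 for L, η > 0 is the landed folklore lemma `B11KernelDictionary.len_pos`; it is not restated here
-- (gate dedup.landed, p183352) and not imported (that module sits on the B9/B11 import chain) — the one-line proof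
-- `mul_pos (pow_pos hL _) hη` is inlined as a local `have hlen` where needed.)

/-- A site of scale ≤ j + 1 has L^{scale}η ≤ L·(L^jη) (L ≥ 1, η ≥ 0). [cite: Balaban1984PropagatorsII, (2.70) p.235] -/
theorem len_le_of_scale_le (hL : 1 ≤ g.L) (hη : 0 ≤ g.eta) {y : g.Site} {j : ℕ} (h : g.scale y ≤ j + 1) :
    g.len y ≤ g.L * (g.L ^ j * g.eta) := by
  unfold B6.Geometry.len
  calc g.L ^ g.scale y * g.eta ≤ g.L ^ (j + 1) * g.eta :=
        mul_le_mul_of_nonneg_right (pow_le_pow_right₀ hL h) hη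
    _ = g.L * (g.L ^ j * g.eta) := by rw [pow_succ]; ring

/-- THE POWER BOOKKEEPING of C-adv4-40: with a = L^{j′}η ≤ L·b, e = L^jη ≤ L·b (b = L^{j_□}η the scale of the cube:
both sites lie in a cube *"connected with a L^{j_□}η-scale"*, so their scales are j_□ or j_□ + 1),
a^d/b^{d+4} ≤ L^{d+4}/e⁴. [cite: Balaban1984PropagatorsII, (2.81) p.237 + (2.87) p.238] -/
theorem scale_bookkeeping (d : ℕ) {L b a e : ℝ} (hb : 0 < b) (ha0 : 0 ≤ a) (he0 : 0 < e) (ha : a ≤ L * b)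
    (he : e ≤ L * b) : a ^ d / b ^ (d + 4) ≤ L ^ (d + 4) / e ^ 4 := by
  rw [div_le_div_iff₀ (pow_pos hb _) (pow_pos he0 _)]
  calc a ^ d * e ^ 4 ≤ (L * b) ^ d * (L * b) ^ 4 :=
        mul_le_mul (pow_le_pow_left₀ ha0 ha d) (pow_le_pow_left₀ he0.le he 4) (by positivity)
          (pow_nonneg (ha0.trans ha) _)
    _ = L ^ (d + 4) * b ^ (d + 4) := by ring

end ScaleFacts

section Prop23

variable {g : B6.Geometry} [DecidableEq g.Site]

/-- **PROPOSITION 2.3 ON THE CARRIER (matrix form).**  If X·C = 1 − R on 𝔅, |mat C y y′| ≤ A·P(y)e^{−δ₁d(y,y′)},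
|mat R y y′| ≤ θe^{−δ₁d(y,y′)}, (2.61) and (2.63) hold at rate δ₁ with constant c (0 ≤ (1−α)δ₁, (2.54), d(y,y) = 0,
d ≥ 0) and θc < 1 (*"for M large enough"*), then X = Q′G′²Q′* has a unique (two-sided) inverse G = C(1 − R)⁻¹,
G = C + G·R, with |mat G y y′| ≤ A c (1 − θc)⁻¹ P(y) e^{−(1−α)δ₁d(y,y′)}.
[cite: Balaban1984PropagatorsII, Prop. 2.3 (2.85)–(2.87) p.238] -/
theorem prop23_matrix (c δ₁ α θ A : ℝ) (P : g.Site → ℝ) (hA : 0 ≤ A) (hP : ∀ y, 0 ≤ P y) (hθ : 0 ≤ θ)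
    (hc : 0 ≤ c) (hαδ : 0 ≤ (1 - α) * δ₁) (htri : Triangle254 g) (hrefl : ∀ y : g.Site, g.dist y y = 0)
    (hdnn : ∀ y y' : g.Site, 0 ≤ g.dist y y') (h261 : Ineq261With c g δ₁ α) (h263 : Ineq263With c g δ₁ α)
    (hsmall : θ * c < 1) {X C R : Module.End ℝ (g.Site → ℝ)} (hXC : X * C = 1 - R)
    (hC : ∀ y y', |mat C y y'| ≤ A * P y * Real.exp (-(δ₁ * g.dist y y')))
    (hR : ∀ y y', |mat R y y'| ≤ θ * Real.exp (-(δ₁ * g.dist y y'))) :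
    ∃ G : Module.End ℝ (g.Site → ℝ), G * X = 1 ∧ X * G = 1 ∧ G = C + G * R ∧
      (∀ G' : Module.End ℝ (g.Site → ℝ), G' * X = 1 → G' = G) ∧
      ∀ y y', |mat G y y'| ≤ A * c * (1 - θ * c)⁻¹ * P y * Real.exp (-((1 - α) * δ₁ * g.dist y y')) := by
  obtain ⟨G, hGX, hXG, hfix, huniq⟩ :=
    inverse_exists_unique hXC hsmall (rowSum_le hθ hαδ hdnn h261 hR)
  exact ⟨G, hGX, hXG, hfix, huniq,
    neumann_majorant c δ₁ α θ A P hA hP hθ hc hαδ htri hrefl hdnn h261 h263 hsmall hC hR hfix⟩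

/-- **(2.87) LITERALLY, in the pairing (2.69).**  The kernel of an operator G in the scalar product (2.69) is
G(y, y′) = mat G y y′/(L^{j′}η)^d; if |mat G y y′| ≤ K·((L^jη)⁴)⁻¹·e^{−½δ₁d(y,y′)} (the conclusion of `prop23_matrix` with
P(y) = (L^jη)^{−4}, α = ½, K = A c(1 − θc)⁻¹) then *"|(Q′G′²Q′*)⁻¹(y, y′)| ≤ O(1)(L^jη)^{−4}(L^{j′}η)^{−d}e^{−½δ₁d(y,y′)}"*
with O(1) = K, in the real-power shape of `B6.Prop23Printed`. [cite: Balaban1984PropagatorsII, (2.87) p.238] -/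
theorem kernel_bound_287 (d : ℕ) (hL : 0 < g.L) (hη : 0 < g.eta) {δ₁ K : ℝ} {G : Module.End ℝ (g.Site → ℝ)}
    (hG : ∀ y y', |mat G y y'| ≤ K * (g.len y ^ 4)⁻¹ * Real.exp (-((1 - 1 / 2) * δ₁ * g.dist y y')))
    (y y' : g.Site) :
    |mat G y y' / g.len y' ^ d| ≤
      K * g.len y ^ (-(4 : ℝ)) * g.len y' ^ (-(d : ℝ)) * Real.exp (-(δ₁ / 2 * g.dist y y')) := by
  have hlen : ∀ z : g.Site, 0 < g.len z := fun z => mul_pos (pow_pos hL _) hη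
  have hw : 0 < g.len y' ^ d := pow_pos (hlen y') d
  rw [abs_div, abs_of_pos hw, div_le_iff₀ hw, rpow_neg_four (hlen y).le,
    rpow_neg_natCast' (hlen y').le]
  have h := hG y y'
  have hhalf : (1 - 1 / 2 : ℝ) * δ₁ * g.dist y y' = δ₁ / 2 * g.dist y y' := by ring
  rw [hhalf] at h
  calc |mat G y y'| ≤ K * (g.len y ^ 4)⁻¹ * Real.exp (-(δ₁ / 2 * g.dist y y')) := h
    _ = K * (g.len y ^ 4)⁻¹ * (g.len y' ^ d)⁻¹ * Real.exp (-(δ₁ / 2 * g.dist y y')) * g.len y' ^ d := by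
        field_simp

/-- **PROPOSITION 2.3, PRINTED SHAPE (2.87).**  Under the hypotheses of `prop23_matrix` with P(y) = (L^jη)^{−4} and
α = ½ — X·C = 1 − R ((2.82)), |mat C y y′| ≤ A(L^jη)^{−4}e^{−δ₁d(y,y′)} (glued (2.81), `mat_Cglued_abs_le`),
|mat R y y′| ≤ θe^{−δ₁d(y,y′)} ((2.85), `mat_R282_abs_le`), (2.61)/(2.63) at (δ₁, ½) with constant c, θc < 1 — the
operator X = Q′G′²Q′* has a unique two-sided inverse G = C(1 − R)⁻¹ = *"Σ_{n=0}^∞ CRⁿ"* (G = C + GR) whose kernel in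
the pairing (2.69) satisfies literally *"|(Q′G′²Q′*)⁻¹(y, y′)| ≤ O(1)(L^jη)^{−4}(L^{j′}η)^{−d}e^{−½δ₁d(y,y′)},
y ∈ Λ_j, y′ ∈ Λ_{j′}"* with O(1) = A c(1 − θc)⁻¹. [cite: Balaban1984PropagatorsII, Prop. 2.3 (2.86)–(2.87) p.238] -/
theorem prop23_kernel_287 (d : ℕ) (hL : 0 < g.L) (hη : 0 < g.eta) (c δ₁ θ A : ℝ) (hA : 0 ≤ A) (hθ : 0 ≤ θ)
    (hc : 0 ≤ c) (hδ : 0 ≤ δ₁) (htri : Triangle254 g) (hrefl : ∀ y : g.Site, g.dist y y = 0)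
    (hdnn : ∀ y y' : g.Site, 0 ≤ g.dist y y') (h261 : Ineq261With c g δ₁ (1 / 2))
    (h263 : Ineq263With c g δ₁ (1 / 2)) (hsmall : θ * c < 1) {X C R : Module.End ℝ (g.Site → ℝ)}
    (hXC : X * C = 1 - R)
    (hC : ∀ y y', |mat C y y'| ≤ A * (g.len y ^ 4)⁻¹ * Real.exp (-(δ₁ * g.dist y y')))
    (hR : ∀ y y', |mat R y y'| ≤ θ * Real.exp (-(δ₁ * g.dist y y'))) :
    ∃ G : Module.End ℝ (g.Site → ℝ), G * X = 1 ∧ X * G = 1 ∧ G = C + G * R ∧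
      (∀ G' : Module.End ℝ (g.Site → ℝ), G' * X = 1 → G' = G) ∧
      ∀ y y', |mat G y y' / g.len y' ^ d| ≤
        A * c * (1 - θ * c)⁻¹ * g.len y ^ (-(4 : ℝ)) * g.len y' ^ (-(d : ℝ)) *
          Real.exp (-(δ₁ / 2 * g.dist y y')) := by
  have hαδ : 0 ≤ (1 - 1 / 2) * δ₁ := by positivity
  have hlen : ∀ z : g.Site, 0 < g.len z := fun z => mul_pos (pow_pos hL _) hη
  obtain ⟨G, hGX, hXG, hfix, huniq, hb⟩ :=
    prop23_matrix c δ₁ (1 / 2) θ A (fun y => (g.len y ^ 4)⁻¹) hA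
      (fun y => inv_nonneg.mpr (pow_nonneg (hlen y).le 4)) hθ hc hαδ htri hrefl hdnn h261 h263 hsmall
      hXC hC hR
  exact ⟨G, hGX, hXG, hfix, huniq, fun y y' => kernel_bound_287 d hL hη (fun y y' => hb y y') y y'⟩

end Prop23

/-! ## §6. The assembly of (2.85) from the partial estimates, by the finite overlap of {h_□} -/

section Counting

variable {D : Type} [Fintype D]

/-- At most n₀ cubes pass the test P ⇒ Σ_□ [P □]·K ≤ n₀K (K ≥ 0). [folklore] -/
theorem sum_indicator_le (P : D → Prop) [DecidablePred P] {K : ℝ} (hK : 0 ≤ K) {n₀ : ℕ}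
    (hcard : (Finset.univ.filter P).card ≤ n₀) : ∑ i, (if P i then K else 0) ≤ n₀ * K := by
  rw [← Finset.sum_filter, Finset.sum_const, nsmul_eq_mul]
  exact mul_le_mul_of_nonneg_right (by exact_mod_cast hcard) hK

variable {S : Type} [DecidableEq D]

/-- COUNTING LEMMA.  A double family of matrices T_{□,□′} (□′ = the cube carrying C_{□′}h_{□′}) with: every T_{□′,□′}
bounded by ε_d·E and vanishing where h_{□′}(y′) = 0; every T_{□,□′} (□ ≠ □′) bounded by ε_o·E and vanishing where
h_□(y) = 0 or h_{□′}(y′) = 0; at most n₀ of the h_□ non-zero at any site.  Then |Σ_{□,□′} T_{□,□′}(y, y′)| ≤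
(n₀ε_d + n₀²ε_o)E(y, y′). [folklore] -/
theorem pairSum_abs_le (T : D → D → S → S → ℝ) (hf : D → S → ℝ) {n₀ : ℕ}
    (hover : ∀ y, (Finset.univ.filter fun i => hf i y ≠ 0).card ≤ n₀) {E : S → S → ℝ} (hE : ∀ y y', 0 ≤ E y y')
    {εd εo : ℝ} (hεd : 0 ≤ εd) (hεo : 0 ≤ εo)
    (hdiag : ∀ i y y', |T i i y y'| ≤ εd * E y y') (hdiag0 : ∀ i y y', hf i y' = 0 → T i i y y' = 0)
    (hoff : ∀ i i', i ≠ i' → ∀ y y', |T i i' y y'| ≤ εo * E y y')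
    (hoff0 : ∀ i i', i ≠ i' → ∀ y y', hf i y = 0 ∨ hf i' y' = 0 → T i i' y y' = 0) (y y' : S) :
    |∑ i, ∑ i', T i i' y y'| ≤ (n₀ * εd + n₀ ^ 2 * εo) * E y y' := by
  have hEy : 0 ≤ E y y' := hE y y'
  -- the sum over the cube □ for a fixed □′
  have hcol : ∀ i', ∑ i, |T i i' y y'| ≤ if hf i' y' ≠ 0 then (εd + n₀ * εo) * E y y' else 0 := by
    intro i'
    by_cases h' : hf i' y' ≠ 0
    · rw [if_pos h', ← Finset.add_sum_erase _ _ (Finset.mem_univ i')]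
      have hb : ∀ i ∈ Finset.univ.erase i', |T i i' y y'| ≤ if hf i y ≠ 0 then εo * E y y' else 0 := by
        intro i hi
        have hii : i ≠ i' := Finset.ne_of_mem_erase hi
        by_cases hi0 : hf i y ≠ 0
        · rw [if_pos hi0]; exact hoff i i' hii y y'
        · rw [if_neg hi0, hoff0 i i' hii y y' (Or.inl (not_not.mp hi0)), abs_zero]
      have hrest : ∑ i ∈ Finset.univ.erase i', |T i i' y y'| ≤ n₀ * (εo * E y y') :=
        calc ∑ i ∈ Finset.univ.erase i', |T i i' y y'|
            ≤ ∑ i ∈ Finset.univ.erase i', (if hf i y ≠ 0 then εo * E y y' else 0) := Finset.sum_le_sum hb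
          _ ≤ ∑ i, (if hf i y ≠ 0 then εo * E y y' else 0) :=
              Finset.sum_le_sum_of_subset_of_nonneg (Finset.erase_subset _ _) fun i _ _ => by
                split_ifs
                · exact mul_nonneg hεo hEy
                · exact le_rfl
          _ ≤ n₀ * (εo * E y y') := sum_indicator_le _ (mul_nonneg hεo hEy) (hover y)
      calc |T i' i' y y'| + ∑ i ∈ Finset.univ.erase i', |T i i' y y'| ≤ εd * E y y' + n₀ * (εo * E y y') :=
            add_le_add (hdiag i' y y') hrest
        _ = (εd + n₀ * εo) * E y y' := by ring
    · rw [if_neg h']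
      have h'0 : hf i' y' = 0 := not_not.mp h'
      refine le_of_eq (Finset.sum_eq_zero fun i _ => ?_)
      by_cases hii : i = i'
      · subst hii; rw [hdiag0 i y y' h'0, abs_zero]
      · rw [hoff0 i i' hii y y' (Or.inr h'0), abs_zero]
  calc |∑ i, ∑ i', T i i' y y'| ≤ ∑ i, |∑ i', T i i' y y'| := Finset.abs_sum_le_sum_abs _ _
    _ ≤ ∑ i, ∑ i', |T i i' y y'| := Finset.sum_le_sum fun i _ => Finset.abs_sum_le_sum_abs _ _
    _ = ∑ i', ∑ i, |T i i' y y'| := Finset.sum_comm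
    _ ≤ ∑ i', (if hf i' y' ≠ 0 then (εd + n₀ * εo) * E y y' else 0) := Finset.sum_le_sum fun i' _ => hcol i'
    _ ≤ n₀ * ((εd + n₀ * εo) * E y y') :=
        sum_indicator_le _ (mul_nonneg (add_nonneg hεd (mul_nonneg (Nat.cast_nonneg _) hεo)) hEy) (hover y')
    _ = (n₀ * εd + n₀ ^ 2 * εo) * E y y' := by ring

end Counting

section Assembly

variable {S : Type} [DecidableEq S] {D : Type} [Fintype D] [DecidableEq D]

/-- **THE ASSEMBLY OF (2.85)** for R = `B6Expansion282.R282` with h_□ = `mulOp (hf □)`, □ = `mulOp (pf □)`: if every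
diagonal term R_{□,□}C_□h_□ (= lines 2 + 3 of (2.82) for the cube □) has matrix ≤ ε_d·E(y,y′) and every term
R_{□,□′}C_{□′}h_{□′} with □ ≠ □′ (line 4, the example (2.83)) has matrix ≤ ε_o·E(y,y′), then
|mat R y y′| ≤ (n₀ε_d + n₀²ε_o)·E(y,y′), n₀ = the overlap number of {h_□}: the diagonal terms vanish unless h_□(y′) ≠ 0
(last factor h_□), the off-diagonal ones unless h_□(y) ≠ 0 (leading factor (□′ − 1)h_□²) and h_{□′}(y′) ≠ 0.  With
E = e^{−δ₁d(y,y′)} this is *"|R(y, y′)| ≤ O(M⁻¹)e^{−δ₁d(y,y′)}(L^{j′}η)^{−d}"* in matrix form with θ = n₀ε_d + n₀²ε_o.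
[cite: Balaban1984PropagatorsII, (2.85) p.238] -/
theorem mat_R282_abs_le (x : Module.End ℝ (S → ℝ)) (t c : D → Module.End ℝ (S → ℝ)) (pf hf : D → S → ℝ)
    {n₀ : ℕ} (hover : ∀ y, (Finset.univ.filter fun i => hf i y ≠ 0).card ≤ n₀)
    {E : S → S → ℝ} (hE : ∀ y y', 0 ≤ E y y') {εd εo : ℝ} (hεd : 0 ≤ εd) (hεo : 0 ≤ εo)
    (hdiag : ∀ i y y',
      |mat (Rpair x (fun i => mulOp (pf i)) t (fun i => mulOp (hf i)) i i * c i * mulOp (hf i)) y y'| ≤ εd * E y y')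
    (hoff : ∀ i i', i ≠ i' → ∀ y y',
      |mat (Rpair x (fun i => mulOp (pf i)) t (fun i => mulOp (hf i)) i i' * c i' * mulOp (hf i')) y y'| ≤
        εo * E y y')
    (y y' : S) :
    |mat (R282 x (fun i => mulOp (pf i)) t (fun i => mulOp (hf i)) c) y y'| ≤ (n₀ * εd + n₀ ^ 2 * εo) * E y y' := by
  rw [R282_eq_pairSum, mat_sum]
  simp_rw [mat_sum]
  refine pairSum_abs_le
    (fun i i' y y' => mat (Rpair x (fun i => mulOp (pf i)) t (fun i => mulOp (hf i)) i i' * c i' * mulOp (hf i')) y y')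
    hf hover hE hεd hεo hdiag ?_ hoff ?_ y y'
  · intro i y y' h0
    show mat (_ * mulOp (hf i)) y y' = 0
    rw [mat_mul_mulOp, h0, mul_zero]
  · intro i i' hii y y' h0
    show mat (_ * mulOp (hf i')) y y' = 0
    rcases h0 with h0 | h0
    · rw [mat_mul_mulOp]
      simp only [Rpair, if_neg hii]
      have hre : (mulOp (pf i') - 1) * (mulOp (hf i) * mulOp (hf i)) * x * mulOp (hf i') * c i' =
          (mulOp (pf i') - 1) * (mulOp (hf i) * mulOp (hf i)) * (x * mulOp (hf i') * c i') := by
        simp only [mul_assoc]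
      rw [hre, mat_offDiag_row, h0]
      ring
    · rw [mat_mul_mulOp, h0, mul_zero]

/-! ### θ = O(M⁻¹) from the siblings' sizes; *"for M large enough"* -/

/-- e^{−κM} ≤ 1/(eκM) for κ, M > 0 (from t e^{−βt} ≤ 1/(eβ), `B6Expansion282.mul_exp_neg_le`). [folklore] -/
theorem exp_neg_mul_le_inv {κ M : ℝ} (hκ : 0 < κ) (hM : 0 < M) :
    Real.exp (-(κ * M)) ≤ 1 / (Real.exp 1 * κ * M) := by
  have h := mul_exp_neg_le hκ M
  have h' : M * Real.exp (-(κ * M)) * (Real.exp 1 * κ) ≤ 1 := by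
    have := (le_div_iff₀ (by positivity : 0 < Real.exp 1 * κ)).mp h
    linarith
  rw [le_div_iff₀ (by positivity)]
  calc Real.exp (-(κ * M)) * (Real.exp 1 * κ * M) = M * Real.exp (-(κ * M)) * (Real.exp 1 * κ) := by ring
    _ ≤ 1 := h'

/-- **θ = O(M⁻¹).**  With the sizes of the three families — ε_d = κ₂/M + κ₃e^{−c₃M} (the commutator family,
`B6Expansion282.line2Ker_abs_le_285`, and the family with G′(□̃)² − G′², `…B6DomainMajorantSandwich`: *"an estimate has
the factor e^{−δ₀M}"*) and ε_o = κ₄e^{−c₄M} (the family □ ≠ □′, `…B6Ineq283`: the factor e^{−⅛δ₀M} of (2.83)) —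
θ = n₀ε_d + n₀²ε_o ≤ K/M with K = n₀(κ₂ + κ₃/(e c₃)) + n₀²κ₄/(e c₄): the printed *"O(M⁻¹)"* of (2.85) with its constant
explicit in the free data. [cite: Balaban1984PropagatorsII, (2.85) p.238] -/
theorem theta_le_inv_M {M κ₂ κ₃ c₃ κ₄ c₄ n : ℝ} (hM : 0 < M) (hc₃ : 0 < c₃) (hc₄ : 0 < c₄) (hκ₃ : 0 ≤ κ₃)
    (hκ₄ : 0 ≤ κ₄) (hn : 0 ≤ n) :
    n * (κ₂ / M + κ₃ * Real.exp (-(c₃ * M))) + n ^ 2 * (κ₄ * Real.exp (-(c₄ * M))) ≤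
      (n * (κ₂ + κ₃ / (Real.exp 1 * c₃)) + n ^ 2 * (κ₄ / (Real.exp 1 * c₄))) / M := by
  have h3 : κ₃ * Real.exp (-(c₃ * M)) ≤ κ₃ / (Real.exp 1 * c₃) / M :=
    calc κ₃ * Real.exp (-(c₃ * M)) ≤ κ₃ * (1 / (Real.exp 1 * c₃ * M)) :=
          mul_le_mul_of_nonneg_left (exp_neg_mul_le_inv hc₃ hM) hκ₃
      _ = κ₃ / (Real.exp 1 * c₃) / M := by
          field_simp
  have h4 : κ₄ * Real.exp (-(c₄ * M)) ≤ κ₄ / (Real.exp 1 * c₄) / M :=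
    calc κ₄ * Real.exp (-(c₄ * M)) ≤ κ₄ * (1 / (Real.exp 1 * c₄ * M)) :=
          mul_le_mul_of_nonneg_left (exp_neg_mul_le_inv hc₄ hM) hκ₄
      _ = κ₄ / (Real.exp 1 * c₄) / M := by
          field_simp
  calc n * (κ₂ / M + κ₃ * Real.exp (-(c₃ * M))) + n ^ 2 * (κ₄ * Real.exp (-(c₄ * M)))
      ≤ n * (κ₂ / M + κ₃ / (Real.exp 1 * c₃) / M) + n ^ 2 * (κ₄ / (Real.exp 1 * c₄) / M) :=
        add_le_add (mul_le_mul_of_nonneg_left (add_le_add le_rfl h3) hn)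
          (mul_le_mul_of_nonneg_left h4 (sq_nonneg n))
    _ = (n * (κ₂ + κ₃ / (Real.exp 1 * c₃)) + n ^ 2 * (κ₄ / (Real.exp 1 * c₄))) / M := by
        simp only [div_eq_mul_inv]
        ring

/-- **"for M large enough".**  If θ ≤ K/M and M ≥ 2Kc (c ≥ 0 the (2.61)-constant) then θc ≤ ½, θc < 1 and
(1 − θc)⁻¹ ≤ 2: the located smallness of Prop. 2.3 (cell SMALLNESS.md) as an explicit threshold.
[cite: Balaban1984PropagatorsII, p.238] -/
theorem smallness_of_M_large {θ K c M : ℝ} (hM : 0 < M) (hc : 0 ≤ c) (hθK : θ ≤ K / M)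
    (hKM : 2 * K * c ≤ M) : θ * c ≤ 1 / 2 ∧ θ * c < 1 ∧ (1 - θ * c)⁻¹ ≤ 2 := by
  have h1 : θ * c ≤ K / M * c := mul_le_mul_of_nonneg_right hθK hc
  have h2 : K / M * c ≤ 1 / 2 := by
    rw [div_mul_eq_mul_div, div_le_iff₀ hM]
    linarith
  have hθc : θ * c ≤ 1 / 2 := h1.trans h2
  refine ⟨hθc, by linarith, ?_⟩
  rw [inv_le_comm₀ (by linarith) (by norm_num : (0 : ℝ) < 2)]
  linarith

end Assembly

/-! ## §7. The majorant of the glued approximate inverse C = Σ_□ h_□C_□h_□ from (2.81) -/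

section GluedC

variable {g : B6.Geometry} [DecidableEq g.Site] {D : Type} [Fintype D]

/-- The matrix of one glued piece h_□C_□h_□: h_□(y)·(L^{j′}η)^dC_□(y,y′)·h_□(y′). [cite: Balaban1984PropagatorsII, (2.70) p.235] -/
theorem mat_piece (hfi : g.Site → ℝ) (w : g.Site → ℝ) (K : g.Site → g.Site → ℝ) (y y' : g.Site) :
    mat (mulOp hfi * kerOp w K * mulOp hfi) y y' = hfi y * (w y' * K y y') * hfi y' := by
  rw [mat_mul_mulOp, mat_mulOp_mul, mat_kerOp]

/-- **THE MAJORANT OF C = Σ_□ h_□C_□h_□** (the hypothesis `hC` of `prop23_matrix`): from (2.81) in the form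
|C_□(y,y′)| ≤ B_C(L^{j_□}η)^{−d−4}e^{−δ₁d(y,y′)} on supp h_□ × supp h_□, |h_□| ≤ 1, the overlap number n₀ and the
one-cube scale fact scale ≤ j_□ + 1 on supp h_□:  |mat C y y′| ≤ n₀B_C L^{d+4}(L^jη)^{−4}e^{−δ₁d(y,y′)}
(weights (L^{j′}η)^d of (2.69); A = n₀B_C L^{d+4}, P(y) = (L^jη)^{−4}). [cite: Balaban1984PropagatorsII, (2.81) p.237 + (2.87) p.238] -/
theorem mat_Cglued_abs_le (d : ℕ) (hL : 1 ≤ g.L) (hη : 0 < g.eta) (hf : D → g.Site → ℝ)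
    (Ck : D → g.Site → g.Site → ℝ) (js : D → ℕ) {n₀ : ℕ}
    (hover : ∀ y, (Finset.univ.filter fun i => hf i y ≠ 0).card ≤ n₀) (hh1 : ∀ i y, |hf i y| ≤ 1)
    (hsc : ∀ i y, hf i y ≠ 0 → g.scale y ≤ js i + 1) {BC δ₁ : ℝ} (hBC : 0 ≤ BC)
    (h281 : ∀ i y y', hf i y ≠ 0 → hf i y' ≠ 0 →
      |Ck i y y'| ≤ BC / (g.L ^ js i * g.eta) ^ (d + 4) * Real.exp (-(δ₁ * g.dist y y')))
    (y y' : g.Site) :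
    |mat (Cglued (fun i => mulOp (hf i)) (fun i => kerOp (fun z => g.len z ^ d) (Ck i))) y y'| ≤
      n₀ * (BC * g.L ^ (d + 4)) * (g.len y ^ 4)⁻¹ * Real.exp (-(δ₁ * g.dist y y')) := by
  have hL0 : 0 < g.L := zero_lt_one.trans_le hL
  have hlen : ∀ z : g.Site, 0 < g.len z := fun z => mul_pos (pow_pos hL0 _) hη
  set K : ℝ := BC * g.L ^ (d + 4) * (g.len y ^ 4)⁻¹ * Real.exp (-(δ₁ * g.dist y y')) with hK
  have hK0 : 0 ≤ K := by positivity
  have hterm : ∀ i, |mat (mulOp (hf i) * kerOp (fun z => g.len z ^ d) (Ck i) * mulOp (hf i)) y y'| ≤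
      if hf i y' ≠ 0 then K else 0 := by
    intro i
    rw [mat_piece]
    by_cases hy' : hf i y' ≠ 0
    · rw [if_pos hy']
      by_cases hy : hf i y ≠ 0
      · have hb : 0 < g.L ^ js i * g.eta := mul_pos (pow_pos hL0 _) hη
        have hbook := scale_bookkeeping d hb (hlen y').le (hlen y)
          (len_le_of_scale_le hL hη.le (hsc i y' hy')) (len_le_of_scale_le hL hη.le (hsc i y hy))
        have hmid : |g.len y' ^ d * Ck i y y'| ≤ K := by
          rw [abs_mul, abs_of_pos (pow_pos (hlen y') d)]
          calc g.len y' ^ d * |Ck i y y'|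
              ≤ g.len y' ^ d * (BC / (g.L ^ js i * g.eta) ^ (d + 4) * Real.exp (-(δ₁ * g.dist y y'))) :=
                mul_le_mul_of_nonneg_left (h281 i y y' hy hy') (pow_nonneg (hlen y').le d)
            _ = BC * (g.len y' ^ d / (g.L ^ js i * g.eta) ^ (d + 4)) * Real.exp (-(δ₁ * g.dist y y')) := by
                ring
            _ ≤ BC * (g.L ^ (d + 4) / g.len y ^ 4) * Real.exp (-(δ₁ * g.dist y y')) :=
                mul_le_mul_of_nonneg_right (mul_le_mul_of_nonneg_left hbook hBC) (Real.exp_nonneg _)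
            _ = K := by rw [hK]; ring
        calc |hf i y * (g.len y' ^ d * Ck i y y') * hf i y'|
            = |hf i y| * |g.len y' ^ d * Ck i y y'| * |hf i y'| := by rw [abs_mul, abs_mul]
          _ ≤ 1 * K * 1 :=
              mul_le_mul (mul_le_mul (hh1 i y) hmid (abs_nonneg _) zero_le_one) (hh1 i y') (abs_nonneg _)
                (mul_nonneg zero_le_one hK0)
          _ = K := by ring
      · rw [not_not.mp hy]
        simpa using hK0
    · rw [if_neg hy', not_not.mp hy']
      simp
  unfold Cglued
  rw [mat_sum]
  calc |∑ i, mat (mulOp (hf i) * kerOp (fun z => g.len z ^ d) (Ck i) * mulOp (hf i)) y y'|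
      ≤ ∑ i, |mat (mulOp (hf i) * kerOp (fun z => g.len z ^ d) (Ck i) * mulOp (hf i)) y y'| :=
        Finset.abs_sum_le_sum_abs _ _
    _ ≤ ∑ i, (if hf i y' ≠ 0 then K else 0) := Finset.sum_le_sum fun i _ => hterm i
    _ ≤ n₀ * K := sum_indicator_le _ hK0 (hover y')
    _ = n₀ * (BC * g.L ^ (d + 4)) * (g.len y ^ 4)⁻¹ * Real.exp (-(δ₁ * g.dist y y')) := by rw [hK]; ring

end GluedC

end Literature.MathematicalPhysics.QuantumFieldTheory.Balaban1983to89.B6Prop23Chain
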